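import Mathlib
import Literature.Probability.LatticeModels.GKSInequalities
import Summits.CriticalPhenomena.Ising3DConformalLimit.Theses.PrecisionLaplacian
import Summits.CriticalPhenomena.Ising3DConformalLimit.Theorems.PrecisionLaplacianInverseMFerromagnetCofactorSignOfPosV
import Summits.CriticalPhenomena.Ising3DConformalLimit.Theorems.PrecisionLaplacianInverseMFerromagnetImOfCofactorSign
import HarnessLib

/-!
# Crux `PrecisionLaplacian.InverseMFerromagnet` (stmt-CriticalPhenomena-4798) — line `es-replica-involution`
# (strategist s1, 2026-08-17): the Edwards–Sokal replica normal form of core B, concluded through the landed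
# bridges B1 `stub_cofactorSign_of_posV` (p95446) and B2 `stub_im_of_cofactorSign` (p95449).

THE CRUX (IM).  For a finite zero-field pair ferromagnet (`gksExpect univ K C`, `K ≥ 0`, `|C i| = 2`) with spin
second-moment matrix `Σ_{pq} = ⟨σ_pσ_q⟩`, every off-diagonal entry of `Σ⁻¹` is `≤ 0`.

THE LINE.  Write `X_i = e^{2K_i} − 1 ≥ 0` (the FK/Edwards–Sokal variable).  Then `Z·Σ = M(X)` with the multi-affine
polynomial matrix `M(X)_{pq} = Σ_ω σ_pσ_q Π_i (1 + a_i(ω) X_i)`, `a_i(ω) = (1+ω_{C_i})/2 ∈ {0,1}` ("bond `i` aligned"),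
and `(Σ⁻¹)_{xy}` has the sign of the adjugate entry `adj M(X)_{xy}`.  Expanding every entry as
`M(X)_{pq} = Σ_{F ⊆ [m]} X^F · W(F;p,q)`, `W(F;p,q) = Σ_ω σ_pσ_q Π_{e∈F} a_e(ω)` (`= 2^{c(F)}·[p ~_F q]`: one
Edwards–Sokal REPLICA `(F, ω)` per row, uniform weight), and the determinant by Leibniz, the coefficient of `X^d` in
`adj M(X)_{xy}` is the SIGNED REPLICA COUNT
  `S(d) = Σ_{σ ∈ 𝔖_n, σ x = y} sgn σ · Σ_{(F_i)_{i ≠ x}, Σ_i 𝟙_{F_i} = d} Π_{i ≠ x} W(F_i; σ i, i)`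
— an integer: a signed count of pairs (permutation `σ` with `σ x = y`; one replica `(F_i, ω_i)` per column `i ≠ x`
in which row `σ i` is `F_i`-connected to `i`), the sign being `sgn σ`.  The stubs:
* E1 `stub_adjugate_coeff_expansion` (identity, M-sized): `coeff_d (adj M(X))_{xy} = S(d)`.
* E2 `stub_signedReplicaCount_nonpos` (the combinatorial core, ≥ L): `S(d) ≤ 0` for pair supports and `x ≠ y`.
  This is POS-v (c1's core B, de-registered from `Sketch` v6 only to keep ≤ 7 stubs; never refuted) in the form an
  LGV / switching involution acts on: uniform-weight objects, sign = parity of `σ`.  Negative objects at the lowest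
  level are the direct connections (`σ = (x y)`, replica of column `y` joins `x`), positive ones the two-step
  connections (`σ = (x y i)`: `x ~_{F_i} i`, `i ~_{F_y} y`) — `n = 3` is coefficientwise GKS II in the FK variable.
* Composition: E1+E2 ⇒ POS-v verbatim ⇒ (B1) the real adjugate entry of `Z·Σ` is `≤ 0` for `K ≥ 0` ⇒ (B2) IM.

WHY EASIER THAN THE CRUX (Transfer, C⁺ = POS-v ⇒ IM strictly): (i) `S(d) ≤ 0` is a family of INTEGER inequalities,
one per (multigraph, pair, exponent), each a finite signed count with UNIFORM weights — exactly the setting of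
sign-reversing involutions (switching lemma = the `n = 3` case for currents; LGV; heaps of pieces), which the analytic
normal forms (Law₂, PCM, B♯ — all ⇔ IM, near-cancelling differences of reals) do not offer; (ii) it is the only normal
form in which the q = 2 specificity demanded by the disprover's FK-q barrier is BUILT IN (`2^{c(F)}` = number of spin
labellings ⇒ weight 1 per replica `(F, ω)`; for `q ≠ 2` there is no such uniformisation and IM(q) is false for
`q < 2`); (iii) base cases are decidable per multigraph (`native_decide` on `S(d)`), so an induction on `m` or on
`|supp d|` can lean on kernel-certified small cases (the ccert lane already certifies univariate shadows up to n = 20);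
(iv) exact zeros and the theta law are visible termwise: `S(d) = 0` unless `supp d` contains three internally
disjoint `x–y` paths (Menger; coefficient of a monomial = coefficient in the sub-multigraph `supp d`).
Evidence for E2: all coefficients for all graphs n ≤ 5 and all 103 connected n = 6 graphs with m ≤ 11 (c1 worker,
exact); univariate Bernstein/ray shadows for 44 named graphs n ≤ 20 + 5×5 torus (ccert, in-tree checker);
this seat: identity E1 checked exactly on 30 random multigraphs n ≤ 4, signs on 1640 (multigraph, pair) cases n ≤ 5
(exp/es_replica.py), and kit j023649 (merged-coefficient 2–5-class exact slices on K₆…K₈, K₃₄, K₄₄, W₆, cube, Wagner,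
Petersen, prism₅, 3×3 torus, random 3-connected n = 7–9).
HONEST RISK: E2 is strictly stronger than IM; a coefficient sign failure at n ≥ 7 kills this line, not the crux
(padded-switching data: the CURRENT (Taylor-in-K) analogue is false unpadded from n = 4 on; the FK variable X has
`(1−t)`-type padding built in and no failure is known).

DISPROOF USED (`Cruxes/InverseMFerromagnet/Disproof.lean` v6, read 2026-08-17T07:00Z): `inverseM_false_without_nonneg`
— `K ≥ 0` enters at B1 only (`X = e^{2K} − 1 ≥ 0` evaluation of a polynomial with nonpositive coefficients);
`inverseM_false_without_pair` — `|C i| = 2` is a hypothesis of E2 and is USED: only for pair supports is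
`W(F;p,q) = 2^{c(F)}[p ~_F q]` a cluster count (for a 4-set `C i`, `a_i(ω) = 1` is a parity condition, no clusters,
and POS-v must fail since IM does); `not_precisionAntitone` — no monotonicity in any coupling is used (coefficientwise
sign ≠ monotone values: `adj` has positive t-coefficients on W₅ and u-coefficients on K₄, but none in X as far as
checked); `inverseM_tight_at_twoSeparator` — respected termwise (iv).  No `-- Targets` section; no landed Negative lemma
concerns polynomial coefficients.
-/

namespace Summit.CriticalPhenomena.Ising3DConformalLimit.Cruxes.InverseMFerromagnet.EsReplicaInvolution

open Literature.Probability.LatticeModels Finset Matrix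
open Summit.CriticalPhenomena.Ising3DConformalLimit.Theses.PrecisionLaplacian (InverseMFerromagnet)
open Summit.CriticalPhenomena.Ising3DConformalLimit.Cruxes.InverseMFerromagnet.PartialCovarianceLadder
  (stub_cofactorSign_of_posV stub_im_of_cofactorSign)

noncomputable section

/-- The Edwards–Sokal polynomial matrix `M(X)_{pq} = Σ_ω σ_pσ_q Π_i (1 + ((1+ω_{C_i})/2)·X_i)` over
`ℝ[X_1,…,X_m]` (verbatim the matrix of the landed bridge `stub_cofactorSign_of_posV`): at `X_i = e^{2K_i} − 1`
it evaluates to `e^{Σ K}·Z·Σ`. [folklore] -/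
def esMatrix (n m : ℕ) (C : Fin m → Finset (Fin n)) : Matrix (Fin n) (Fin n) (MvPolynomial (Fin m) ℝ) :=
  Matrix.of fun p q : Fin n => ∑ ω : SpinConfig (Fin n), MvPolynomial.C (spinAt p ω * spinAt q ω) *
    ∏ i : Fin m, (1 + MvPolynomial.C ((1 + spinProduct (C i) ω) / 2) * MvPolynomial.X i)

/-- The replica row weight `W(F; p, q) = Σ_ω σ_pσ_q Π_{e ∈ F} (1+ω_{C_e})/2` — the coefficient of `X^F` in
`M(X)_{pq}`; for pair supports it equals `2^{c(F)}·[p ~_F q]` (number of spin labellings constant on the clusters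
of the bond set `F`, times the indicator that `p, q` share a cluster). [folklore] -/
def replicaWeight (n m : ℕ) (C : Fin m → Finset (Fin n)) (F : Finset (Fin m)) (p q : Fin n) : ℝ :=
  ∑ ω : SpinConfig (Fin n), spinAt p ω * spinAt q ω * ∏ e ∈ F, (1 + spinProduct (C e) ω) / 2

/-- The exponent vector `Σ_i 𝟙_{F_i}` of a replica assignment `F : columns → bond sets`. [folklore] -/
def replicaDegree (n m : ℕ) (F : Fin n → Finset (Fin m)) : Fin m →₀ ℕ :=
  ∑ i : Fin n, ∑ e ∈ F i, Finsupp.single e 1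

/-- The SIGNED REPLICA COUNT `S(d) = Σ_{σ : σ x = y} sgn σ Σ_{(F_i)_{i≠x}: Σ𝟙_{F_i} = d} Π_{i ≠ x} W(F_i; σ i, i)`
(column `x` carries no replica: `F x = ∅`; Leibniz in Mathlib's convention `det M = Σ_σ sgn σ Π_i M (σ i) i`,
`adjugate M x y = det (M.updateRow y (Pi.single x 1))`). [folklore] -/
def signedReplicaCount (n m : ℕ) (C : Fin m → Finset (Fin n)) (x y : Fin n) (d : Fin m →₀ ℕ) : ℝ :=
  ∑ σ : Equiv.Perm (Fin n), ∑ F : Fin n → Finset (Fin m),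
    if σ x = y ∧ F x = ∅ ∧ replicaDegree n m F = d then
      ((Equiv.Perm.sign σ : ℤ) : ℝ) * ∏ i ∈ Finset.univ.erase x, replicaWeight n m C (F i) (σ i) i
    else 0

/-- **E1 · coefficient expansion (identity).**  Every coefficient of every adjugate entry of the Edwards–Sokal
matrix is the signed replica count: `coeff_d (adj M(X))_{xy} = S(d)`.  Proof sketch: `adjugate_apply` +
`det_apply` (row `y` replaced by `e_x` forces `σ x = y` and kills the factor of column `x`), then expand
`Π_{i≠x} M(X)_{σ i, i}` with `M(X)_{pq} = Σ_F X^F · W(F;p,q)` (`Finset.prod_sum` over the bond sets, `prod_add`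
for `Π_i (1 + a_i X_i) = Σ_F Π_{e∈F} a_e X_e`) and read off the coefficient of `X^d`
(`MvPolynomial.coeff_monomial`).  Checked exactly against brute force on 30 random multigraphs, n ≤ 4
(exp/es_replica.py).  No hypothesis on `C`. [folklore] -/
theorem stub_adjugate_coeff_expansion :
    ∀ (n m : ℕ) (C : Fin m → Finset (Fin n)) (x y : Fin n) (d : Fin m →₀ ℕ),
      ((Matrix.of fun p q : Fin n => ∑ ω : SpinConfig (Fin n),
        MvPolynomial.C (spinAt p ω * spinAt q ω) *
          ∏ i : Fin m, (1 + MvPolynomial.C ((1 + spinProduct (C i) ω) / 2) * MvPolynomial.X i)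
        : Matrix (Fin n) (Fin n) (MvPolynomial (Fin m) ℝ)).adjugate x y).coeff d
      = (∑ σ : Equiv.Perm (Fin n), ∑ F : Fin n → Finset (Fin m),
        if σ x = y ∧ F x = ∅ ∧ (∑ i : Fin n, ∑ e ∈ F i, Finsupp.single e 1 : Fin m →₀ ℕ) = d then
          ((Equiv.Perm.sign σ : ℤ) : ℝ) * ∏ i ∈ Finset.univ.erase x,
            ∑ ω : SpinConfig (Fin n), spinAt (σ i) ω * spinAt i ω * ∏ e ∈ F i, (1 + spinProduct (C e) ω) / 2
        else 0) := by
  sorry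

/-- **E2 · the combinatorial core (POS-v in replica form).**  For PAIR supports and `x ≠ y` every signed replica
count is nonpositive: `S(d) ≤ 0`.  Equivalently: among the uniform-weight objects (σ with σ x = y; one
Edwards–Sokal replica `(F_i, ω_i)` per column `i ≠ x`, `ω_i` constant on the `F_i`-clusters, row `σ i` in the
`F_i`-cluster of `i`; total bond multiset `d`), the odd permutations outnumber the even ones.  Lowest level
(`n = 3`): coefficientwise GKS II in the FK variable; an LGV/switching involution exchanging cluster pieces between
two replicas is the intended mechanism.  Strictly stronger than the crux; verified for all graphs n ≤ 5, all
connected n = 6 graphs with m ≤ 11 (c1 worker, exact), univariate shadows to n = 20 (ccert), kit j023649 (this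
seat).  WLOG simple graphs (parallel bonds: substitute `X ↦ Π(1+X_copy) − 1`, nonnegative coefficients) and
`supp d` theta-connected between `x` and `y` (else `S(d) = 0`). [folklore] -/
theorem stub_signedReplicaCount_nonpos :
    ∀ (n m : ℕ) (C : Fin m → Finset (Fin n)), (∀ i, (C i).card = 2) → ∀ x y : Fin n, x ≠ y →
      ∀ d : Fin m →₀ ℕ,
      (∑ σ : Equiv.Perm (Fin n), ∑ F : Fin n → Finset (Fin m),
        if σ x = y ∧ F x = ∅ ∧ (∑ i : Fin n, ∑ e ∈ F i, Finsupp.single e 1 : Fin m →₀ ℕ) = d then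
          ((Equiv.Perm.sign σ : ℤ) : ℝ) * ∏ i ∈ Finset.univ.erase x,
            ∑ ω : SpinConfig (Fin n), spinAt (σ i) ω * spinAt i ω * ∏ e ∈ F i, (1 + spinProduct (C e) ω) / 2
        else 0) ≤ 0 := by
  sorry


/-- The stubs are stated INLINE over tree declarations only (so that a Theorems file can restate them verbatim for
`--supports`); this records that E1's two sides are `coeff_d (adj (esMatrix n m C))_{xy}` and `signedReplicaCount`.
[folklore] -/
theorem signedReplicaCount_eq (n m : ℕ) (C : Fin m → Finset (Fin n)) (x y : Fin n) (d : Fin m →₀ ℕ) :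
    signedReplicaCount n m C x y d
      = ∑ σ : Equiv.Perm (Fin n), ∑ F : Fin n → Finset (Fin m),
        if σ x = y ∧ F x = ∅ ∧ (∑ i : Fin n, ∑ e ∈ F i, Finsupp.single e 1 : Fin m →₀ ℕ) = d then
          ((Equiv.Perm.sign σ : ℤ) : ℝ) * ∏ i ∈ Finset.univ.erase x,
            ∑ ω : SpinConfig (Fin n), spinAt (σ i) ω * spinAt i ω * ∏ e ∈ F i, (1 + spinProduct (C e) ω) / 2
        else 0 := rfl

theorem esMatrix_adjugate_coeff_eq (n m : ℕ) (C : Fin m → Finset (Fin n)) (x y : Fin n) (d : Fin m →₀ ℕ) :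
    ((esMatrix n m C).adjugate x y).coeff d = signedReplicaCount n m C x y d :=
  stub_adjugate_coeff_expansion n m C x y d

/-- POS-v (core B, verbatim the hypothesis of the landed bridge `stub_cofactorSign_of_posV`) from E1 + E2.
[folklore] -/
theorem posV_of_stubs :
    ∀ (n m : ℕ) (C : Fin m → Finset (Fin n)), (∀ i, (C i).card = 2) → ∀ x y : Fin n, x ≠ y →
      ∀ d : Fin m →₀ ℕ, ((Matrix.of fun p q : Fin n => ∑ ω : SpinConfig (Fin n),
        MvPolynomial.C (spinAt p ω * spinAt q ω) *
          ∏ i : Fin m, (1 + MvPolynomial.C ((1 + spinProduct (C i) ω) / 2) * MvPolynomial.X i)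
        : Matrix (Fin n) (Fin n) (MvPolynomial (Fin m) ℝ)).adjugate x y).coeff d ≤ 0 := by
  intro n m C hC x y hxy d
  rw [stub_adjugate_coeff_expansion n m C x y d]
  exact stub_signedReplicaCount_nonpos n m C hC x y hxy d

/-- **`InverseMFerromagnet_of`** — the crux BY NAME from the two stubs: E1 + E2 give POS-v, the landed bridge B1
(`stub_cofactorSign_of_posV`, p95446) turns coefficientwise nonpositivity into nonpositivity of the real adjugate
entries of `Z·Σ` for `K ≥ 0`, and B2 (`stub_im_of_cofactorSign`, p95449) divides by `det > 0`. [folklore] -/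
theorem InverseMFerromagnet_of : InverseMFerromagnet :=
  stub_im_of_cofactorSign (stub_cofactorSign_of_posV posV_of_stubs)

end

end Summit.CriticalPhenomena.Ising3DConformalLimit.Cruxes.InverseMFerromagnet.EsReplicaInvolution
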